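import Summits.ABC.StewartYu.ArchShapeDepElim
import Literature.NumberTheory.DiophantineGeometry.MultiplicativeGroupApproximationThm328Proofs
import HarnessLib

/-!
# Cell abc-stewartyu — draft route `YuMatveevShapeRat` (plan-m3 g2): the archimedean SHAPE bound for
# `log|1 − ζ∏ξᵢ^{bᵢ}|` (signs and `|Λ|` versus `|e^Λ − 1|`), proved from the dependence-free core

Cell `abc-stewartyu` (HOME `run/shared/lean/pub/abc-stewartyu/`; seat `lit-abc-yu2007` g3). Theorems only;
no definition, no named fact, nothing closed. Third archimedean ingredient of the draft item
`ArchShapeChain : ArchCoreRat → ArchHalf` (after `ArchShapeDepElim.lean`): from the shape bound for linear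
forms in logarithms of ARBITRARY positive rationals (`Λ ≠ 0`; the conclusion of `archShape_dep_of_indep`)
to the bound `log|1 − Ξ| ≥ −c'ʳ ∏Aᵢ log(eB)` for `Ξ = ζ ∏ ξᵢ^{bᵢ} ≠ 1`, `ζ = ±1`, NON-ZERO rationals `ξᵢ`
of any sign, `h(ξᵢ) ≤ Aᵢ`, `1 ≤ Aᵢ`, `|bᵢ| ≤ B`, `1 ≤ B` (`archShape_oneSub_of_dep`, `c' = |c| + 2`), and
the composite from the planner's `ArchCoreRat` text (`archShape_oneSub_of_indep`). This is the input of
Evertse–Győry's §4.4.2 at the infinite place with `α = 1` BEFORE the choice of small exponents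
(`exists_small_exponents`, Prop. 4.4.1) and the Case A/B comparison of `log(eB)` with `log h(Ξ)` — those
two steps, K-parametric, remain. Argument: if `|1 − Ξ| ≥ 1/2` the bound is trivial (`c'ʳ ∏A log(eB) ≥ 1`);
otherwise `Ξ > 1/2`, `log Ξ = ∑ bᵢ log|ξᵢ|` is a non-zero linear form in the logarithms of the positive
rationals `|ξᵢ|` (`h(|ξᵢ|) = h(ξᵢ)`), and `|log Ξ| ≤ 2|Ξ − 1|` (`log x ≤ x − 1`, `1 − 1/x ≤ log x`), so the
core bound loses only `log 2 ≤ ∏A log(eB)`. WHAT THIS IS NOT: no analytic estimate; no crux moved; no abc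
claim. References: [EvertseGyory2015] §4.4 (pp. 80–81), proof of Thm. 3.2.8 (p. 63); [Matveev2000] §21.
-/

open Height Real Finset
open Literature.NumberTheory.DiophantineGeometry.Dioph

noncomputable section

namespace Summit.ABC.StewartYu

/-- **`log|1 − ζ∏ξᵢ^{bᵢ}| ≥ −c'ʳ ∏Aᵢ log(eB)` from the dependence-free archimedean shape bound.** The
hypothesis is the conclusion of `archShape_dep_of_indep` (all positive rationals, `Λ ≠ 0`); the conclusion
is the same currency for `Ξ = ζ∏ξᵢ^{bᵢ} ≠ 1` with non-zero rationals `ξᵢ` of any sign and `ζ = ±1`,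
`c' = |c| + 2`. [cite: EvertseGyory2015, §4.4 (pp. 80–81); proof of Thm 3.2.8 (p. 63)] -/
theorem archShape_oneSub_of_dep
    (h : ∃ c : ℝ, ∀ (r : ℕ) (a : Fin r → ℚ) (b : Fin r → ℤ) (A : Fin r → ℝ) (B : ℝ),
      (∀ i, 0 < a i) →
      (∀ i, Height.logHeight₁ (a i) ≤ A i) → (∀ i, 1 ≤ A i) →
      (∀ i, (|b i| : ℝ) ≤ B) →
      ∑ i, (b i : ℝ) * Real.log (a i : ℝ) ≠ 0 →
      -(c ^ r * (∏ i, A i) * Real.log (Real.exp 1 * B)) ≤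
        Real.log |∑ i, (b i : ℝ) * Real.log (a i : ℝ)|) :
    ∃ c : ℝ, ∀ (r : ℕ) (ξ : Fin r → ℚ) (b : Fin r → ℤ) (A : Fin r → ℝ) (B : ℝ) (ζ : ℚ),
      (ζ = 1 ∨ ζ = -1) → (∀ i, ξ i ≠ 0) →
      (∀ i, Height.logHeight₁ (ξ i) ≤ A i) → (∀ i, 1 ≤ A i) →
      (∀ i, (|b i| : ℝ) ≤ B) → 1 ≤ B → ζ * ∏ i, ξ i ^ b i ≠ 1 →
      -(c ^ r * (∏ i, A i) * Real.log (Real.exp 1 * B)) ≤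
        Real.log |1 - ((ζ * ∏ i, ξ i ^ b i : ℚ) : ℝ)| := by
  obtain ⟨c, hc⟩ := h
  refine ⟨|c| + 2, fun r ξ b A B ζ hζ hξ hAh hA1 hbB hB1 hΞ1 => ?_⟩
  set Ξq : ℚ := ζ * ∏ i, ξ i ^ b i with hΞq
  have hA0 : ∀ i, 0 < A i := fun i => lt_of_lt_of_le one_pos (hA1 i)
  have hE := Real.exp_pos 1
  have hB0 : 0 < B := by linarith
  have hL1 : 1 ≤ Real.log (Real.exp 1 * B) := by
    rw [Real.log_mul hE.ne' hB0.ne', Real.log_exp]; linarith [Real.log_nonneg hB1]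
  have hP1 : 1 ≤ ∏ i, A i := by
    rw [← Finset.prod_const_one (s := (univ : Finset (Fin r)))]
    exact Finset.prod_le_prod (fun _ _ => zero_le_one) fun i _ => hA1 i
  have hc2 : 2 ≤ |c| + 2 := by linarith [abs_nonneg c]
  have hcr1 : 1 ≤ (|c| + 2) ^ r := one_le_pow₀ (by linarith)
  -- the right-hand side is at least `∏A log(eB) ≥ 1 ≥ log 2` in absolute value
  have hRHS1 : (∏ i, A i) * Real.log (Real.exp 1 * B) ≤
      (|c| + 2) ^ r * (∏ i, A i) * Real.log (Real.exp 1 * B) := by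
    have := mul_le_mul_of_nonneg_right hcr1 (by positivity : 0 ≤ (∏ i, A i) * Real.log (Real.exp 1 * B))
    linarith
  have hPL1 : 1 ≤ (∏ i, A i) * Real.log (Real.exp 1 * B) := one_le_mul_of_one_le_of_one_le hP1 hL1
  have hlog2 : Real.log 2 < 1 := by have := Real.log_two_lt_d9; linarith
  by_cases hfar : 1 / 2 ≤ |1 - (Ξq : ℝ)|
  · -- trivial case
    have h1 : Real.log (1 / 2) ≤ Real.log |1 - (Ξq : ℝ)| := Real.log_le_log (by norm_num) hfar
    rw [Real.log_div one_ne_zero two_ne_zero, Real.log_one] at h1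
    linarith
  push Not at hfar
  -- `Ξ > 1/2`, `log Ξ = ∑ bᵢ log|ξᵢ| ≠ 0`, `|log Ξ| ≤ 2|Ξ − 1|`
  have hΞpos : (0 : ℝ) < (Ξq : ℝ) := by
    have := abs_lt.mp hfar; linarith [this.2]
  set a : Fin r → ℚ := fun i => |ξ i| with ha
  have ha0 : ∀ i, 0 < a i := fun i => abs_pos.mpr (hξ i)
  have habsΞ : |(Ξq : ℝ)| = ∏ i, ((a i : ℚ) : ℝ) ^ b i := by
    rw [hΞq]; push_cast
    rw [abs_mul, Finset.abs_prod]
    have hζ1 : |(ζ : ℝ)| = 1 := by rcases hζ with h | h <;> simp [h]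
    rw [hζ1, one_mul]
    refine Finset.prod_congr rfl fun i _ => ?_
    rw [abs_zpow]; simp [ha]
  have hlogΞ : Real.log (Ξq : ℝ) = ∑ i, (b i : ℝ) * Real.log (a i : ℝ) := by
    rw [← abs_of_pos hΞpos, habsΞ, Real.log_prod]
    · exact Finset.sum_congr rfl fun i _ => by rw [Real.log_zpow]
    · intro i _; exact zpow_ne_zero _ (by exact_mod_cast (ha0 i).ne')
  have hΛne : ∑ i, (b i : ℝ) * Real.log (a i : ℝ) ≠ 0 := by
    rw [← hlogΞ]
    intro h0
    have h1 : (Ξq : ℝ) = 1 := Real.eq_one_of_pos_of_log_eq_zero hΞpos h0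
    exact hΞ1 (by exact_mod_cast h1)
  have hcore := hc r a b A B ha0 (fun i => by rw [ha]; dsimp only; rw [logHeight₁_abs]; exact hAh i)
    hA1 hbB hΛne
  rw [← hlogΞ] at hcore
  -- `|log x| ≤ 2|x − 1|` for `|x − 1| ≤ 1/2` (`log x ≤ x − 1`, `1 − 1/x ≤ log x`); the same lemma is
  -- `Literature.NumberTheory.Automorphic.abs_log_le_two_mul`, not imported here (automorphic cone)
  have h2 : |Real.log (Ξq : ℝ)| ≤ 2 * |(Ξq : ℝ) - 1| := by
    have hx : |(Ξq : ℝ) - 1| ≤ 1 / 2 := by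
      rw [show (Ξq : ℝ) - 1 = -(1 - (Ξq : ℝ)) by ring, abs_neg]; exact hfar.le
    have hx1 : 1 / 2 ≤ (Ξq : ℝ) := by rw [abs_le] at hx; linarith [hx.1]
    have hl1 : Real.log (Ξq : ℝ) ≤ (Ξq : ℝ) - 1 := Real.log_le_sub_one_of_pos hΞpos
    have hl2 : 1 - (Ξq : ℝ)⁻¹ ≤ Real.log (Ξq : ℝ) := Real.one_sub_inv_le_log_of_pos hΞpos
    rw [abs_le]
    rcases le_or_gt 1 (Ξq : ℝ) with h | h
    · rw [abs_of_nonneg (by linarith)]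
      constructor <;> nlinarith [Real.log_nonneg h]
    · rw [abs_of_neg (by linarith)]
      have hinv : (Ξq : ℝ)⁻¹ ≤ 2 := by rw [inv_le_comm₀ hΞpos (by norm_num)]; linarith
      have h3 : 1 - (Ξq : ℝ)⁻¹ ≥ 2 * ((Ξq : ℝ) - 1) := by
        have h4 : (1 - (Ξq : ℝ)⁻¹) = ((Ξq : ℝ) - 1) * (Ξq : ℝ)⁻¹ := by field_simp
        rw [h4]; nlinarith [inv_pos.mpr hΞpos]
      constructor <;> nlinarith
  have hΞne : (Ξq : ℝ) - 1 ≠ 0 := by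
    intro h0; exact hΞ1 (by exact_mod_cast (sub_eq_zero.mp h0))
  have hlogpos : 0 < |Real.log (Ξq : ℝ)| := abs_pos.mpr (by rw [hlogΞ]; exact hΛne)
  have h3 : Real.log |Real.log (Ξq : ℝ)| ≤ Real.log 2 + Real.log |1 - (Ξq : ℝ)| := by
    have h4 := Real.log_le_log hlogpos h2
    rw [Real.log_mul two_ne_zero (abs_ne_zero.mpr hΞne), show (Ξq : ℝ) - 1 = -(1 - (Ξq : ℝ)) by ring,
      abs_neg] at h4
    exact h4
  -- constants: `c^r + 1 ≤ (|c| + 2)^r` (here `r ≥ 1`, as `r = 0` forces `Ξ = ζ = −1`, the trivial case)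
  have hr : r ≠ 0 := by
    rintro rfl
    apply hΛne
    simp
  have hpow : c ^ r + 1 ≤ (|c| + 2) ^ r := by
    have h1 : c ^ r ≤ |c| ^ r := by rw [← abs_pow]; exact le_abs_self _
    have h2 : |c| ^ r + 2 ^ r ≤ (|c| + 2) ^ r := pow_add_pow_le (abs_nonneg c) zero_le_two hr
    have h3 : (1 : ℝ) ≤ 2 ^ r := one_le_pow₀ (by norm_num)
    linarith
  have h5 : (c ^ r + 1) * ((∏ i, A i) * Real.log (Real.exp 1 * B)) ≤
      (|c| + 2) ^ r * ((∏ i, A i) * Real.log (Real.exp 1 * B)) :=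
    mul_le_mul_of_nonneg_right hpow (by positivity)
  have h6 : Real.log 2 ≤ 1 * ((∏ i, A i) * Real.log (Real.exp 1 * B)) := by linarith
  nlinarith [h5, h6, hcore, h3]

/-- **Composite: from the planner's `ArchCoreRat` text to `log|1 − ζ∏ξᵢ^{bᵢ}| ≥ −c'ʳ ∏Aᵢ log(eB)`**
(`archShape_dep_of_indep`, then `archShape_oneSub_of_dep`). [cite: EvertseGyory2015, §4.4 (pp. 80–81)] -/
theorem archShape_oneSub_of_indep
    (h : ∃ c : ℝ, ∀ (r : ℕ) (a : Fin r → ℚ) (b : Fin r → ℤ) (A : Fin r → ℝ) (B : ℝ),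
      (∀ i, 0 < a i) →
      (∀ μ : Fin r → ℤ, ∏ i, a i ^ μ i = 1 → μ = 0) →
      (∀ i, Height.logHeight₁ (a i) ≤ A i) → (∀ i, 1 ≤ A i) →
      b ≠ 0 → (∀ i, (|b i| : ℝ) ≤ B) →
      -(c ^ r * (∏ i, A i) * Real.log (Real.exp 1 * B)) ≤
        Real.log |∑ i, (b i : ℝ) * Real.log (a i : ℝ)|) :
    ∃ c : ℝ, ∀ (r : ℕ) (ξ : Fin r → ℚ) (b : Fin r → ℤ) (A : Fin r → ℝ) (B : ℝ) (ζ : ℚ),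
      (ζ = 1 ∨ ζ = -1) → (∀ i, ξ i ≠ 0) →
      (∀ i, Height.logHeight₁ (ξ i) ≤ A i) → (∀ i, 1 ≤ A i) →
      (∀ i, (|b i| : ℝ) ≤ B) → 1 ≤ B → ζ * ∏ i, ξ i ^ b i ≠ 1 →
      -(c ^ r * (∏ i, A i) * Real.log (Real.exp 1 * B)) ≤
        Real.log |1 - ((ζ * ∏ i, ξ i ^ b i : ℚ) : ℝ)| :=
  archShape_oneSub_of_dep (archShape_dep_of_indep h)

end Summit.ABC.StewartYu

end
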